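import Literature.Algebra.Lie.ChevalleyEilenbergFunctoriality
import HarnessLib

/-!
# Post-composition of Chevalley–Eilenberg cochains with partially equivariant linear maps

Topic `Algebra/Lie`; namespace `Literature.Algebra.Lie.ChevalleyEilenberg`.

For the change of pair `(id_L, ψ)` with `ψ : M → M'` merely *linear*, post-composition
`f ↦ ψ ∘ f` (`post L ψ q = pull M L id ψ q`) is not a cochain map, but it still commutes with the
insertion operators, and with `θ_x` for every single `x ∈ L` whose action `ψ` intertwines
(`lieDer_post_of_comm`, by the Cartan recursion `i_y θ_x = θ_x i_y − i_{[x,y]}`). Consequently,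
for a reductive pair `(𝔤, K)`, post-composition with a `K`-equivariant and `𝔨`-equivariant linear
map preserves — and, for injective `ψ`, reflects — membership in the relative complexes
`C^•(𝔤, K; -)` (`mem_gK_post_of_comm`, `mem_gK_of_post_mem`). Together with the elementary
exactness of post-composition on all cochains (`post_injective`,
`exists_post_eq_of_post_eq_zero`) this is the algebraic half of the statement that a short exact
sequence of `(𝔤, K)`-modules which splits `K`-equivariantly gives a degreewise short exact
sequence of relative cochain complexes (Borel–Wallach, I §2.2: "all exact sequences in
`𝒞_{𝔤,𝔨}` split over `𝔨`"); the `(𝔤, K)`-module half is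
`Literature/NumberTheory/Automorphic/GKCohomologyShortExact.lean`.

No `sorry`, no new named facts.

## References
* [ChevalleyEilenberg1948] C. Chevalley, S. Eilenberg, *Cohomology theory of Lie groups and Lie
  algebras*, Trans. AMS 63 (1948), §23 (23.5), §28.
* [BorelWallach2000] A. Borel, N. Wallach, *Continuous cohomology, discrete subgroups, and
  representations of reductive groups*, 2nd ed., AMS 2000, I §1.1–§1.3, §2.2.
-/

namespace Literature.Algebra.Lie.ChevalleyEilenberg

open Function

/- [extends Literature/Algebra/Lie/ChevalleyEilenbergFunctoriality]: the change of pair with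
`φ = id` and a non-equivariant `ψ`. -/

variable {R : Type*} [CommRing R] {L : Type*} [LieRing L] [LieAlgebra R L]
  {M : Type*} [AddCommGroup M] [Module R M] [LieRingModule L M] [LieModule R L M]
  {M' : Type*} [AddCommGroup M'] [Module R M'] [LieRingModule L M'] [LieModule R L M']
  {Γ : Type*} [Group Γ]

/-! #### Post-composition `ψ ∘ f` -/

variable (L) in
/-- Post-composition of cochains with a linear map `ψ : M → M'` (the change of pair
`(id, ψ)` of `ChevalleyEilenbergFunctoriality`, with `ψ` merely linear). [folklore] -/
abbrev post (ψ : M →ₗ[R] M') (q : ℕ) : Cochain R L M q →ₗ[R] Cochain R L M' q :=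
  pull M L (LieHom.id : L →ₗ⁅R⁆ L) ψ q

omit [LieRingModule L M] [LieModule R L M] [LieRingModule L M'] [LieModule R L M'] in
/-- Unfolding. [folklore] -/
@[simp] theorem post_apply (ψ : M →ₗ[R] M') (q : ℕ) (f : Cochain R L M q) (v : Fin q → L) :
    post L ψ q f v = ψ (f v) := rfl

omit [LieRingModule L M] [LieModule R L M] [LieRingModule L M'] [LieModule R L M'] in
/-- Insertion commutes with post-composition. [folklore] -/
theorem ins_post (ψ : M →ₗ[R] M') (q : ℕ) (x : L) (f : Cochain R L M (q + 1)) :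
    ins q x (post L ψ (q + 1) f) = post L ψ q (ins q x f) :=
  ins_pull _ ψ q x f

omit [LieRingModule L M] [LieModule R L M] [LieRingModule L M'] [LieModule R L M'] in
/-- Post-composition with an injective map is injective. [folklore] -/
theorem post_injective {ψ : M →ₗ[R] M'} (hψ : Injective ψ) (q : ℕ) :
    Injective (post L ψ q) := by
  intro f g h
  ext v
  exact hψ (by simpa using congrArg (fun F => F v) h)

omit [LieRingModule L M] [LieModule R L M] [LieRingModule L M'] [LieModule R L M'] in
/-- Post-compositions compose. [folklore] -/
theorem post_comp_apply {M'' : Type*} [AddCommGroup M''] [Module R M''] (ψ : M →ₗ[R] M')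
    (ψ' : M' →ₗ[R] M'') (q : ℕ) (f : Cochain R L M q) :
    post L ψ' q (post L ψ q f) = post L (ψ' ∘ₗ ψ) q f := by
  ext v; rfl

/-- **`θ_x (ψ ∘ f) = ψ ∘ θ_x f` as soon as `ψ` commutes with the action of this one `x`**
(induction on the degree through Cartan's relation `i_y θ_x = θ_x i_y - i_{⁅x,y⁆}`).
[cite: ChevalleyEilenberg1948, §23 (23.5)] -/
theorem lieDer_post_of_comm (ψ : M →ₗ[R] M') (x : L) (hx : ∀ m : M, ψ ⁅x, m⁆ = ⁅x, ψ m⁆) :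
    ∀ (q : ℕ) (f : Cochain R L M q),
      lieDer R L M' q x (post L ψ q f) = post L ψ q (lieDer R L M q x f)
  | 0, f => by
    ext v
    simp only [lieDer_zero_apply, post_apply]
    exact (hx _).symm
  | q + 1, f => by
    refine ext_ins fun y => ?_
    rw [ins_lieDer, ins_post, lieDer_post_of_comm ψ x hx q, ins_post, ins_post, ins_lieDer,
      map_sub]

omit [LieModule R L M] [LieModule R L M'] in
/-- The group action `(σ, τ)` under post-composition with a `τ`-intertwiner. [folklore] -/
theorem act_post_of_comm (A : PairAction R L M Γ) (A' : PairAction R L M' Γ) (ψ : M →ₗ[R] M')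
    (hσ : ∀ g, A.σ g = A'.σ g) (hψ : ∀ g m, ψ (A.τ g m) = A'.τ g (ψ m)) (g : Γ) (q : ℕ)
    (f : Cochain R L M q) :
    A'.act g q (post L ψ q f) = post L ψ q (A.act g q f) := by
  ext v
  simp only [PairAction.act_apply, post_apply, hψ, hσ]

/-! #### `(𝔤, K)`-membership is preserved by `K`- and `𝔨`-equivariant post-composition -/

/-- **Relative cochains are preserved.** If `ψ` commutes with `τ(g)` for all `g ∈ K` and with
the action of every `x ∈ 𝔨`, then `f ↦ ψ ∘ f` maps the `(𝔤, K)`-complex of `M` into that of `M'`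
(carriers only: `ψ` need not be a `𝔤`-module map, so this is not a cochain map in general). This
is how a `𝔨`-splitting of an exact sequence of `(𝔤, 𝔨)`-modules splits the relative cochain
complexes degreewise. [cite: BorelWallach2000, I §2.2] -/
theorem mem_gK_post_of_comm (K : LieSubalgebra R L) (A : PairAction R L M Γ)
    (A' : PairAction R L M' Γ) (ψ : M →ₗ[R] M') (hσ : ∀ g, A.σ g = A'.σ g)
    (hψ : ∀ g m, ψ (A.τ g m) = A'.τ g (ψ m)) (h𝔨 : ∀ x ∈ K, ∀ m : M, ψ ⁅x, m⁆ = ⁅x, ψ m⁆)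
    (q : ℕ) (f : Cochain R L M q) (hf : f ∈ (Subcomplex.gK R L M K A).carrier q) :
    post L ψ q f ∈ (Subcomplex.gK R L M' K A').carrier q := by
  rw [Subcomplex.mem_gK_iff] at hf ⊢
  refine ⟨?_, fun g => by rw [act_post_of_comm A A' ψ hσ hψ, hf.2 g]⟩
  cases q with
  | zero =>
    rw [Subcomplex.mem_rel_zero_iff] at hf ⊢
    intro x hx
    rw [lieDer_post_of_comm ψ x (h𝔨 x hx), hf.1 x hx, map_zero]
  | succ q =>
    rw [Subcomplex.mem_rel_succ_iff] at hf ⊢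
    intro x hx
    rw [lieDer_post_of_comm ψ x (h𝔨 x hx), (hf.1 x hx).1, map_zero, ins_post, (hf.1 x hx).2,
      map_zero]
    exact ⟨rfl, rfl⟩

/-- **… and reflected** when `ψ` is moreover injective. [cite: BorelWallach2000, I §2.2] -/
theorem mem_gK_of_post_mem (K : LieSubalgebra R L) (A : PairAction R L M Γ)
    (A' : PairAction R L M' Γ) (ψ : M →ₗ[R] M') (hinj : Injective ψ) (hσ : ∀ g, A.σ g = A'.σ g)
    (hψ : ∀ g m, ψ (A.τ g m) = A'.τ g (ψ m)) (h𝔨 : ∀ x ∈ K, ∀ m : M, ψ ⁅x, m⁆ = ⁅x, ψ m⁆)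
    (q : ℕ) (f : Cochain R L M q) (hf : post L ψ q f ∈ (Subcomplex.gK R L M' K A').carrier q) :
    f ∈ (Subcomplex.gK R L M K A).carrier q := by
  rw [Subcomplex.mem_gK_iff] at hf ⊢
  refine ⟨?_, fun g => post_injective hinj q ?_⟩
  · cases q with
    | zero =>
      rw [Subcomplex.mem_rel_zero_iff] at hf ⊢
      intro x hx
      refine post_injective hinj 0 ?_
      rw [← lieDer_post_of_comm ψ x (h𝔨 x hx), hf.1 x hx, map_zero]
    | succ q =>
      rw [Subcomplex.mem_rel_succ_iff] at hf ⊢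
      intro x hx
      refine ⟨post_injective hinj (q + 1) ?_, post_injective hinj q ?_⟩
      · rw [← lieDer_post_of_comm ψ x (h𝔨 x hx), (hf.1 x hx).1, map_zero]
      · rw [← ins_post, (hf.1 x hx).2, map_zero]
  · rw [← act_post_of_comm A A' ψ hσ hψ, hf.2 g]

/-! #### Restriction of cochains to a submodule containing all values -/

omit [LieRingModule L M] [LieModule R L M] in
/-- A cochain all of whose values lie in `p` factors through `p`. [folklore] -/
def codRestrict (p : Submodule R M) (q : ℕ) (f : Cochain R L M q) (h : ∀ v, f v ∈ p) :
    Cochain R L p q :=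
  AlternatingMap.codRestrict f p h

omit [LieRingModule L M] [LieModule R L M] in
/-- [folklore] -/
@[simp] theorem post_subtype_codRestrict (p : Submodule R M) (q : ℕ) (f : Cochain R L M q)
    (h : ∀ v, f v ∈ p) : post L p.subtype q (codRestrict p q f h) = f := by
  ext v; rfl

omit [LieRingModule L M] [LieModule R L M] [LieRingModule L M'] [LieModule R L M'] in
/-- **Exactness of post-composition**: if `ψ` is injective and `ker ψ' ⊆ range ψ`, then a cochain
killed by `ψ' ∘ -` is of the form `ψ ∘ f`. [folklore] -/
theorem exists_post_eq_of_post_eq_zero {M'' : Type*} [AddCommGroup M''] [Module R M'']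
    (ψ : M →ₗ[R] M') (hinj : Injective ψ) (ψ' : M' →ₗ[R] M'')
    (hex : ∀ m', ψ' m' = 0 → ∃ m, ψ m = m') (q : ℕ) (g : Cochain R L M' q)
    (hg : post L ψ' q g = 0) :
    ∃ f : Cochain R L M q, post L ψ q f = g := by
  have hval : ∀ v, g v ∈ LinearMap.range ψ := fun v => by
    obtain ⟨m, hm⟩ := hex (g v) (by simpa using congrArg (fun F => F v) hg)
    exact ⟨m, hm⟩
  refine ⟨post L ((LinearEquiv.ofInjective ψ hinj).symm : LinearMap.range ψ →ₗ[R] M) q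
    (codRestrict (LinearMap.range ψ) q g hval), ?_⟩
  ext v
  simp only [post_apply, LinearEquiv.coe_coe]
  have h := congrArg Subtype.val
    ((LinearEquiv.ofInjective ψ hinj).apply_symm_apply ⟨g v, hval v⟩)
  rw [LinearEquiv.ofInjective_apply] at h
  exact h

end Literature.Algebra.Lie.ChevalleyEilenberg
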